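import Summits.QuantumFields.BalabanUV.T4Continuum.Support.NE9HoloFamilyPotentialKPG

/-!
# NE9HoloFamilyOffCentre — route R4♯-T's RECORD CLAUSE (T-c): the vacuum-subtracted slice of the record maps the table ball
# into an OFF-CENTRE ball `closedBall (cY k) (2B)` whose centre `cY k` = the slice of the explicit part `explZ k` is HISTORY-FREE
# and small, `‖cY k‖ ≤ p̄₀` — from the SAME letters as E132's centred clause (budget `2B + p̄₀`)

Cell `pub-balaban`, T4-DAG §6 NE9; BINDER row NE9 OWNER lineage `b2b-balaban-t4-ne9-p1` gen 62, CRUX PROVER NE9 (ruling e34b3e0c (2));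
route R4 ∕ R4♯ ∕ R4♯-T of `t4/ROUTES-NE9.md` v9.0.1 (rank 1).  Piece **(T-c)** of the owner's INTERFACE word on R4♯-T (CLAIMS.log
2026-08-21T09:4xZ l.29955, HOME/INBOX 09:5xZ; refuter PRICING-NE9 v10 §E F-v10-4 ∕ Q-v10-1 «R4♯-T, OFF-CENTRE IMAGES — no obstruction»):
(T-a) the off-centre polydisc Schwarz–Pick chain (leaf lineage `…-leaf-03`, `NE9PolydiscChainOffCentre`), (T-b) the off-centre step lemma
(leaf lineage `…-leaf-04`, `NE9FutureProfileStepOffCentre.holoMaps_step_offCentre(_free)`: binders `cY : ℕ → 𝔜`,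
`hΦoff : ∀ k, ∀ g ∈ W, MapsTo (Φ k (g k)) (ball 0 r) (closedBall (cY k) B₁)`, `hcY : ∀ k, ‖cY k‖ ≤ cbar₀`), (T-c) = THIS FILE: the
record's instance of exactly those two binders, with `B₁ = 2B` and `cbar₀ = p̄₀`, for the vacuum-subtracted slice
`holoSlice κ σ Φc`, `Φc k s Q U X := newTerm act k s U X Q − newTerm act k s U₀ X Q + explZ k U X` of D6 ∕ E127 ∕ E132.

HONEST FRAMING (T4-DAG PAGE 1).  Rung (B)+1 of the FINITE-VOLUME T⁴ programme — NOT infinite volume, NOT a mass gap, NOT Clay.  NE9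
(`T4OutputRate.NE9` ∧ `FadingMemory`) is a cell NEW ESTIMATE, NOT PRINTED in [I] = [Balaban1987RG1] (CMP **109**), [II] =
[Balaban1988RG2Cluster] (CMP **116**), NOT PROVED for Bałaban's E^{(j)}.  This file proves NO END: it is the (Φ-size) clause of the
record's slice map in its OFF-CENTRE form, from the displayed Bałaban-side letters `PotentialKPG W act m a d R₀` (= (R-0)[scope]
«[II] Lemma 3 (2.38) read over Lemma 2's box», TYPE (2.14)∕(2.15) p. 15, (2.38) p. 20), `hdec`, `hpin` (budget `B`), and the explicit
part's letter `hexplZ`∕`hp₀` (TYPE [I] (2.14) p. 268 ∕ [II] (2.41) p. 21).  W1 = model O-NE9-1 untouched; spine 0∕9.  HONEST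
DEPENDENCY (cell line, verbatim): continuum YM on T⁴ ⇐ BetaPertH ∧ nine spine estimates (0/9 proved); BetaPertH ⇐ (D1) ∧ (D4) ∧
CAP+tail; G-an2-4 gates asym, D1 and NE2/3/4.  `FlowStep.BetaPertH`, (B), (B^μ) do not occur; [I]∕[II] for TYPES only (ABSOLUTE
RULE).  0 def, 0 sorry.  A sharper image clause inside a CONDITIONAL END is not progress on the estimate itself.

CONTENT ([folklore]; generic complex-Banach bookkeeping on the tree's `holoSlice` = `pack ∘ coordFun`):
* §1 the slice of a CONSTANT (table-free) real family `e k U X`: its weighted coordinate is `e^{κd(X)}·e k U X` on the creation step and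
  `0` elsewhere (`coordFun_const_real`), hence `‖·‖ ≤ P` from `|e k U X| ≤ e^{−κd(X)}·P` (`norm_coordFun_const_real_le`,
  `norm_holoSlice_const_real_le`); and the ALGEBRA of the symmetrisation: `coordFun (Φv + e) − coordFun e = coordFun Φv`
  coordinatewise (`coordFun_add_const_real_sub`) — a real constant passes through `½(f Q + conj (f (σ Q)))` unchanged.
* §2 **`vacSlice_offCentre_of_potentialKPG`** — THE (T-c) RECORD CLAUSE: under E132 §4's letters (`hσ`, `hiso`; `hKP`, `hdec`, `hpin`,
  `hexplZ`, `hp₀`; `0 ≤ B`, `0 ≤ p̄₀`) the history-free centres `cY k := holoSlice κ σ (fun k _ _ U X => explZ k U X) k 0 0` satisfy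
  `‖cY k‖ ≤ p̄₀` and `MapsTo (holoSlice κ σ Φc k (g k)) (ball 0 R₀) (closedBall (cY k) (2B))` for every step `k` and history `g ∈ W`
  (proof: coordinatewise, the difference IS the weighted symmetrised coordinate of the pure vacuum-subtracted family
  `newTerm_U − newTerm_{U₀}`, of size `≤ 2B` by `norm_newTerm_le_of_potentialKPG` twice and `coordFun_bound`).
* §3 `vacSlice_offCentre_exists` — the ∃-face (`∃ cY : ℕ → 𝔜, (∀ k, ‖cY k‖ ≤ p̄₀) ∧ …`) for (T-b)'s `holoMaps_step_offCentre_free` ∕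
  idea-1's `offCentreMaps_step`; §4 CONSISTENCY: the off-centre clause gives back E132 §4's centred clause with budget `2B + p̄₀`
  (`closedBall (cY k) (2B) ⊆ closedBall 0 (2B + p̄₀)`), so nothing of the record's ENDs (E130∕E132∕E134) is disturbed.
WHAT THIS DOES NOT DO: prove an END (the R4♯-T END at the record = E132∕E134 re-threaded through the END of record's chain-generic
`NE9FutureProfileEndOfRecordSP.…_injRead_of_chain` at (T-a) ∘ (T-b) — filed AFTER those land, by the END-of-record lineage ∕ the owner);
discharge `PotentialKPG` ∕ `hexplZ` ∕ the coupling half; touch W1.  In the refuter's letters (PRICING-NE9 v10 §E): c̄ = τ̄·p̄₀∕R₀ is now a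
kernel quantity of the record (the translation part of the image), t = ω̂ + 2Bτ̄∕R₀ its radius part; the rate gain θ ↦ λ* is (T-a)'s.
DISGUISE TEST: coordinate arithmetic on `ℓ^∞`; nothing of Bałaban's asserted, constructed or discharged.
References (TYPES only): [Balaban1987RG1] T. Bałaban, CMP **109** (1987) 249–301 — (2.13)–(2.14) p. 268; [Balaban1988RG2Cluster]
T. Bałaban, CMP **116** (1988) 1–22 — (2.13)–(2.15) pp. 14–15, (2.38) p. 20, (2.40)–(2.41) p. 21; [KoteckyPreiss1986] R. Kotecký,
D. Preiss, CMP **103** (1986) 491–498, Theorem p. 492; [AhlforsCA1979] L. Ahlfors, Complex Analysis, 3rd ed., ch. 4 §6.5 p. 172.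
Summits-side NEW work (LEAN PLACEMENT RULE); imports E132 `NE9HoloFamilyPotentialKPG` BY NAME; modifies nothing; 0 sorry.
Value = the record's (Φ-size) clause in the off-centre form the translation-aware chain consumes, NOT summit progress.
-/

noncomputable section

namespace Summit.QuantumFields.BalabanUV.T4Continuum.NE9HoloFamilyOffCentre

open Metric Set ComplexConjugate
open scoped BigOperators ENNReal
open Literature.Probability.LatticeModels
open Literature.MathematicalPhysics.QuantumFieldTheory.Balaban1983to89
open Literature.MathematicalPhysics.QuantumFieldTheory.Balaban1983to89.T4OutputRate
open Literature.MathematicalPhysics.QuantumFieldTheory.Balaban1983to89.T4HistoryLipschitzRecursion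
open Literature.MathematicalPhysics.QuantumFieldTheory.Balaban1983to89.T4HistoryLipschitzOuter
open Literature.MathematicalPhysics.QuantumFieldTheory.Balaban1983to89.T4HistoryLipschitzActivity
open Literature.MathematicalPhysics.QuantumFieldTheory.Balaban1983to89.T4HistoryLipschitzSegment
open Literature.MathematicalPhysics.QuantumFieldTheory.Balaban1983to89.T4HistoryLipschitzActivity (ClusterGeom)
open Literature.Analysis.Complex.SymmetryPrincipleBanach
open Summit.QuantumFields.BalabanUV.T4Continuum.NE9EllInftyHolomorphy
open Summit.QuantumFields.BalabanUV.T4Continuum.NE9HoloSliceOfFamily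
open Summit.QuantumFields.BalabanUV.T4Continuum.NE9HoloFamilyPotentialKPG (differentiableOn_newTerm_of_kp1)
open Literature.MathematicalPhysics.QuantumFieldTheory.Balaban1983to89.T4HistoryLipschitzWitness (norm_newTerm_le_of_potentialKPG)

variable {C : Carriers} {Bg ι : Type}

/-! ## §1 The slice of a constant real family, and the algebra of the symmetrisation -/

section Const

variable {κ : ℝ} {σ : lp (fun _ : ι => ℂ) ∞ →L[ℝ] lp (fun _ : ι => ℂ) ∞}

/-- [folklore] The weighted coordinate of the slice of a CONSTANT (table-free) real family `e k U X`: `e^{κd(X)}·e k U X` on the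
creation step `k+1`, `0` elsewhere — a real constant passes through the symmetrisation `½(f Q + conj (f (σ Q)))` unchanged.
[cite: AhlforsCA1979, Ch. 4 §6.5 p. 172] -/
theorem coordFun_const_real (e : ℕ → Bg → C.Dom → ℝ) (k : ℕ) (s : ℝ) (p : Bg × C.Dom) (Q : lp (fun _ : ι => ℂ) ∞) :
    coordFun κ σ (fun k _ _ U X => ((e k U X : ℝ) : ℂ)) k s p Q =
      if C.scale p.2 = k + 1 then ((Real.exp (κ * C.d p.2) * e k p.1 p.2 : ℝ) : ℂ) else 0 := by
  obtain ⟨U, X⟩ := p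
  by_cases hX : C.scale X = k + 1
  · rw [coordFun_of_eq hX, if_pos hX, Complex.conj_ofReal]
    push_cast
    ring
  · rw [coordFun_of_ne hX, if_neg hX]

/-- [folklore] SIZE of the constant slice's coordinates: `|e k U X| ≤ e^{−κd(X)}·P` on the creation step (`P ≥ 0`) gives
`‖coordFun … p Q‖ ≤ P` for every coordinate `p`, every `s` and every table `Q` (the weight cancels the decay factor). -/
theorem norm_coordFun_const_real_le {e : ℕ → Bg → C.Dom → ℝ} {k : ℕ} {P : ℝ} (hP : 0 ≤ P)
    (he : ∀ (U : Bg) (X : C.Dom), C.scale X = k + 1 → |e k U X| ≤ Real.exp (-(κ * C.d X)) * P)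
    (s : ℝ) (p : Bg × C.Dom) (Q : lp (fun _ : ι => ℂ) ∞) :
    ‖coordFun κ σ (fun k _ _ U X => ((e k U X : ℝ) : ℂ)) k s p Q‖ ≤ P := by
  rw [coordFun_const_real]
  split_ifs with hX
  · rw [Complex.norm_real, Real.norm_eq_abs, abs_mul, abs_of_pos (Real.exp_pos _)]
    calc Real.exp (κ * C.d p.2) * |e k p.1 p.2|
        ≤ Real.exp (κ * C.d p.2) * (Real.exp (-(κ * C.d p.2)) * P) :=
          mul_le_mul_of_nonneg_left (he p.1 p.2 hX) (Real.exp_pos _).le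
      _ = P := by rw [← mul_assoc, ← Real.exp_add, add_neg_cancel, Real.exp_zero, one_mul]
  · rw [norm_zero]; exact hP

/-- [folklore] SIZE of the constant slice itself: `‖holoSlice κ σ (e) k s Q‖ ≤ P` under the same letter (`norm_pack_le_of_bound`). -/
theorem norm_holoSlice_const_real_le {e : ℕ → Bg → C.Dom → ℝ} {k : ℕ} {P : ℝ} (hP : 0 ≤ P)
    (he : ∀ (U : Bg) (X : C.Dom), C.scale X = k + 1 → |e k U X| ≤ Real.exp (-(κ * C.d X)) * P)
    (s : ℝ) (Q : lp (fun _ : ι => ℂ) ∞) :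
    ‖holoSlice κ σ (fun k _ _ U X => ((e k U X : ℝ) : ℂ)) k s Q‖ ≤ P :=
  norm_pack_le_of_bound hP fun p => norm_coordFun_const_real_le hP he s p Q

/-- [folklore] On the creation step the constant slice's coordinate IS the weighted letter (the packing is the tuple there). -/
theorem holoSlice_const_real_apply {e : ℕ → Bg → C.Dom → ℝ} {k : ℕ} {P : ℝ} (hP : 0 ≤ P)
    (he : ∀ (U : Bg) (X : C.Dom), C.scale X = k + 1 → |e k U X| ≤ Real.exp (-(κ * C.d X)) * P)
    (s : ℝ) (Q : lp (fun _ : ι => ℂ) ∞) (p : Bg × C.Dom) :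
    (holoSlice κ σ (fun k _ _ U X => ((e k U X : ℝ) : ℂ)) k s Q : Bg × C.Dom → ℂ) p =
      if C.scale p.2 = k + 1 then ((Real.exp (κ * C.d p.2) * e k p.1 p.2 : ℝ) : ℂ) else 0 := by
  rw [holoSlice, pack_apply_of_bound (fun p => norm_coordFun_const_real_le hP he s p Q), coordFun_const_real]

/-- [folklore] THE ALGEBRA OF THE SYMMETRISATION: for a family `Φv` plus a constant real family `e`, coordinatewise
`coordFun (Φv + e) k s p Q − coordFun (e) k s₀ p Q₀ = coordFun Φv k s p Q` — `conj` fixes the real constant, which therefore drops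
out of the difference whatever the second slice's `s₀`, `Q₀` (the constant slice is table-free). [cite: AhlforsCA1979, Ch. 4 §6.5 p. 172] -/
theorem coordFun_add_const_real_sub (Φv : ℕ → ℝ → lp (fun _ : ι => ℂ) ∞ → Bg → C.Dom → ℂ) (e : ℕ → Bg → C.Dom → ℝ)
    (k : ℕ) (s s₀ : ℝ) (p : Bg × C.Dom) (Q Q₀ : lp (fun _ : ι => ℂ) ∞) :
    coordFun κ σ (fun k s Q U X => Φv k s Q U X + ((e k U X : ℝ) : ℂ)) k s p Q -
        coordFun κ σ (fun k _ _ U X => ((e k U X : ℝ) : ℂ)) k s₀ p Q₀ = coordFun κ σ Φv k s p Q := by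
  obtain ⟨U, X⟩ := p
  by_cases hX : C.scale X = k + 1
  · simp only [coordFun_of_eq hX, map_add, Complex.conj_ofReal]
    ring
  · simp only [coordFun_of_ne hX, sub_zero]

end Const

/-! ## §2 THE (T-c) RECORD CLAUSE: the vacuum-subtracted slice maps the table ball into `closedBall (cY k) (2B)`, `‖cY k‖ ≤ p̄₀` -/

section Record

variable {W : Set (ℕ → ℝ)} {κ : ℝ}

/-- **(T-c) THE OFF-CENTRE (Φ-size) CLAUSE OF THE RECORD's VACUUM-SUBTRACTED SLICE FROM `PotentialKPG`.**  Letters: a conjugation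
`σ` of the table space (conjugate-linear `hσ`, isometric `hiso`); the pencil `hKP : PotentialKPG W act m a d R₀` (line-holomorphy +
majorant + KP for `m` on `‖Q‖ < R₀`, at every background incl. `U₀`), `hdec`, `hpin` (budget `B`); the explicit part's letter
`hexplZ`∕`hp₀` (`|explZ k U X| ≤ e^{−κd(X)}·p₀ k`, `p₀ k ≤ p̄₀`); `0 ≤ B`, `0 ≤ p̄₀`.  Conclusion, for the slice
`holoSlice κ σ Φc`, `Φc k s Q U X := newTerm act k s U X Q − newTerm act k s U₀ X Q + explZ k U X`, and the HISTORY-FREE centres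
`cY k := holoSlice κ σ (fun k _ _ U X => explZ k U X) k 0 0` (the slice of the explicit part alone; table-free):
(i) `‖cY k‖ ≤ p̄₀` for every `k`; (ii) `MapsTo (holoSlice κ σ Φc k (g k)) (ball 0 R₀) (closedBall (cY k) (2B))` for every `k` and every
history `g ∈ W`.  Proof: coordinatewise on `ℓ^∞` — by §1 the difference of the two slices IS the weighted symmetrised coordinate of
the pure vacuum-subtracted family `newTerm_U − newTerm_{U₀}`, of size `≤ 2B` (`norm_newTerm_le_of_potentialKPG` twice, `coordFun_bound`).
These are literally the binders `cY`∕`hΦoff`∕`hcY` of (T-b) `holoMaps_step_offCentre_free` with `B₁ := 2B`, `cbar₀ := p̄₀`.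
«NE9 ⇐ the named binders»: no END here; W1 untouched.
[cite: Balaban1987RG1, (2.13)-(2.14) p.268; Balaban1988RG2Cluster, (2.14)-(2.15) p.15, (2.38) p.20, (2.40)-(2.41) p.21; KoteckyPreiss1986, Theorem p.492] -/
theorem vacSlice_offCentre_of_potentialKPG (G : ClusterGeom C) {σ : lp (fun _ : ι => ℂ) ∞ →L[ℝ] lp (fun _ : ι => ℂ) ∞}
    (hσ : ∀ (c : ℂ) (x : lp (fun _ : ι => ℂ) ∞), σ (c • x) = conj c • σ x) (hiso : ∀ x, ‖σ x‖ = ‖x‖)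
    {act : ℕ → ℝ → Bg → lp (fun _ : ι => ℂ) ∞ → G.P → ℂ} {m : ℕ → ℝ → Bg → G.P → ℝ} {a d : G.P → ℝ}
    {δ : C.Dom → ℝ} {U₀ : Bg} {explZ : ℕ → Bg → C.Dom → ℝ} {p₀ : ℕ → ℝ} {R₀ B pbar : ℝ}
    (hB : 0 ≤ B) (hpbar : 0 ≤ pbar) (hKP : G.PotentialKPG W act m a d R₀)
    (hdec : G.DecayExtract δ d) (hpin : G.PinBudget a δ (fun _ => B) κ)
    (hexplZ : ∀ (k : ℕ) (U : Bg) (X : C.Dom), C.scale X = k + 1 → |explZ k U X| ≤ Real.exp (-(κ * C.d X)) * p₀ k)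
    (hp₀ : ∀ k, p₀ k ≤ pbar) :
    (∀ k, ‖holoSlice κ σ (fun k _ _ U X => ((explZ k U X : ℝ) : ℂ)) k 0 0‖ ≤ pbar) ∧
    ∀ k, ∀ g ∈ W, MapsTo
      (holoSlice κ σ (fun k s Q U X => G.newTerm act k s U X Q - G.newTerm act k s U₀ X Q + ((explZ k U X : ℝ) : ℂ)) k (g k))
      (ball (0 : lp (fun _ : ι => ℂ) ∞) R₀)
      (closedBall (holoSlice κ σ (fun k _ _ U X => ((explZ k U X : ℝ) : ℂ)) k 0 0) (2 * B)) := by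
  set Φv : ℕ → ℝ → lp (fun _ : ι => ℂ) ∞ → Bg → C.Dom → ℂ := fun k s Q U X =>
    G.newTerm act k s U X Q - G.newTerm act k s U₀ X Q with hΦv
  have hd : ∀ γ, 0 ≤ d γ := hKP.2.1
  have he : ∀ (k : ℕ) (U : Bg) (X : C.Dom), C.scale X = k + 1 →
      |explZ k U X| ≤ Real.exp (-(κ * C.d X)) * pbar :=
    fun k U X hX => (hexplZ k U X hX).trans (mul_le_mul_of_nonneg_left (hp₀ k) (Real.exp_pos _).le)
  refine ⟨fun k => norm_holoSlice_const_real_le hpbar (he k) 0 0, fun k g hg Q hQ => ?_⟩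
  -- (c-holo) ∕ (c-size) of the PURE vacuum-subtracted family `Φv` on the ball (budget `2B`)
  have hvd : ∀ (U : Bg) (X : C.Dom), C.scale X = k + 1 →
      DifferentiableOn ℂ (fun Q => Φv k (g k) Q U X) (ball 0 R₀) := by
    intro U X hX
    obtain ⟨hhU, hmU, hkU⟩ := hKP.2.2 g hg k U X hX
    obtain ⟨hh0, hm0, hk0⟩ := hKP.2.2 g hg k U₀ X hX
    exact (differentiableOn_newTerm_of_kp1 G hd hhU hmU hkU).sub (differentiableOn_newTerm_of_kp1 G hd hh0 hm0 hk0)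
  have hvb : ∀ (U : Bg) (X : C.Dom), C.scale X = k + 1 → ∀ Q' ∈ ball (0 : lp (fun _ : ι => ℂ) ∞) R₀,
      ‖Φv k (g k) Q' U X‖ ≤ Real.exp (-(κ * C.d X)) * (2 * B) := by
    intro U X hX Q' hQ'
    have h1 := norm_newTerm_le_of_potentialKPG G hKP hdec hpin hg (U := U) hX hQ'
    have h2 := norm_newTerm_le_of_potentialKPG G hKP hdec hpin hg (U := U₀) hX hQ'
    calc ‖Φv k (g k) Q' U X‖
        ≤ ‖G.newTerm act k (g k) U X Q'‖ + ‖G.newTerm act k (g k) U₀ X Q'‖ := norm_sub_le _ _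
      _ ≤ B * Real.exp (-(κ * C.d X)) + B * Real.exp (-(κ * C.d X)) := add_le_add h1 h2
      _ = Real.exp (-(κ * C.d X)) * (2 * B) := by ring
  -- the same two clauses for the FULL family `Φv + explZ` (budget `2B + p̄₀`), so that its packing is the tuple at `Q`
  have hB₁ : 0 ≤ 2 * B + pbar := by positivity
  have hcd : ∀ (U : Bg) (X : C.Dom), C.scale X = k + 1 →
      DifferentiableOn ℂ (fun Q => (fun k s Q U X => Φv k s Q U X + ((explZ k U X : ℝ) : ℂ)) k (g k) Q U X)
        (ball 0 R₀) :=
    fun U X hX => (hvd U X hX).add (differentiableOn_const _)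
  have hcb : ∀ (U : Bg) (X : C.Dom), C.scale X = k + 1 → ∀ Q' ∈ ball (0 : lp (fun _ : ι => ℂ) ∞) R₀,
      ‖(fun k s Q U X => Φv k s Q U X + ((explZ k U X : ℝ) : ℂ)) k (g k) Q' U X‖ ≤
        Real.exp (-(κ * C.d X)) * (2 * B + pbar) := by
    intro U X hX Q' hQ'
    calc ‖Φv k (g k) Q' U X + ((explZ k U X : ℝ) : ℂ)‖
        ≤ ‖Φv k (g k) Q' U X‖ + ‖((explZ k U X : ℝ) : ℂ)‖ := norm_add_le _ _
      _ ≤ Real.exp (-(κ * C.d X)) * (2 * B) + Real.exp (-(κ * C.d X)) * pbar := by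
          refine add_le_add (hvb U X hX Q' hQ') ?_
          rw [Complex.norm_real, Real.norm_eq_abs]
          exact he k U X hX
      _ = Real.exp (-(κ * C.d X)) * (2 * B + pbar) := by ring
  have hcQ : ∀ p : Bg × C.Dom,
      ‖coordFun κ σ (fun k s Q U X => Φv k s Q U X + ((explZ k U X : ℝ) : ℂ)) k (g k) p Q‖ ≤ 2 * B + pbar :=
    fun p => coordFun_bound hσ hiso hB₁ hcd hcb p Q hQ
  -- the full family IS the record's `Φc` (definitional unfolding of `Φv`)
  have hΦc : (fun k s Q U X => G.newTerm act k s U X Q - G.newTerm act k s U₀ X Q + ((explZ k U X : ℝ) : ℂ)) =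
      fun k s Q U X => Φv k s Q U X + ((explZ k U X : ℝ) : ℂ) := rfl
  rw [hΦc, mem_closedBall, dist_eq_norm]
  refine lp.norm_le_of_forall_le (by positivity) fun p => ?_
  rw [lp.coeFn_sub, Pi.sub_apply, holoSlice, holoSlice, pack_apply_of_bound hcQ,
    pack_apply_of_bound (fun p => norm_coordFun_const_real_le hpbar (he k) 0 p 0), coordFun_add_const_real_sub]
  exact coordFun_bound hσ hiso (by positivity) hvd hvb p Q hQ

/-! ## §3 The ∃-face, and §4 consistency with the centred clause of E132 -/

/-- **(T-c), ∃-FACE** — under §2's letters there are HISTORY-FREE centres `cY : ℕ → ℓ^∞(Bg × C.Dom; ℂ)` with `‖cY k‖ ≤ p̄₀` and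
`MapsTo (holoSlice κ σ Φc k (g k)) (ball 0 R₀) (closedBall (cY k) (2B))` for all `k` and all `g ∈ W` — the docking face of (T-b)
`NE9FutureProfileStepOffCentre.holoMaps_step_offCentre_free` (`B₁ := 2B`, `cbar₀ := p̄₀`) and, after `fun k g _ => ⟨cY k, …⟩`, of
idea-1's ∃-form `offCentreMaps_step` (`P₀ := p̄₀`).
[cite: Balaban1987RG1, (2.13)-(2.14) p.268; Balaban1988RG2Cluster, (2.38) p.20, (2.40)-(2.41) p.21] -/
theorem vacSlice_offCentre_exists (G : ClusterGeom C) {σ : lp (fun _ : ι => ℂ) ∞ →L[ℝ] lp (fun _ : ι => ℂ) ∞}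
    (hσ : ∀ (c : ℂ) (x : lp (fun _ : ι => ℂ) ∞), σ (c • x) = conj c • σ x) (hiso : ∀ x, ‖σ x‖ = ‖x‖)
    {act : ℕ → ℝ → Bg → lp (fun _ : ι => ℂ) ∞ → G.P → ℂ} {m : ℕ → ℝ → Bg → G.P → ℝ} {a d : G.P → ℝ}
    {δ : C.Dom → ℝ} {U₀ : Bg} {explZ : ℕ → Bg → C.Dom → ℝ} {p₀ : ℕ → ℝ} {R₀ B pbar : ℝ}
    (hB : 0 ≤ B) (hpbar : 0 ≤ pbar) (hKP : G.PotentialKPG W act m a d R₀)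
    (hdec : G.DecayExtract δ d) (hpin : G.PinBudget a δ (fun _ => B) κ)
    (hexplZ : ∀ (k : ℕ) (U : Bg) (X : C.Dom), C.scale X = k + 1 → |explZ k U X| ≤ Real.exp (-(κ * C.d X)) * p₀ k)
    (hp₀ : ∀ k, p₀ k ≤ pbar) :
    ∃ cY : ℕ → lp (fun _ : Bg × C.Dom => ℂ) ∞, (∀ k, ‖cY k‖ ≤ pbar) ∧
      ∀ k, ∀ g ∈ W, MapsTo
        (holoSlice κ σ (fun k s Q U X => G.newTerm act k s U X Q - G.newTerm act k s U₀ X Q + ((explZ k U X : ℝ) : ℂ))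
          k (g k))
        (ball (0 : lp (fun _ : ι => ℂ) ∞) R₀) (closedBall (cY k) (2 * B)) :=
  ⟨_, vacSlice_offCentre_of_potentialKPG G hσ hiso hB hpbar hKP hdec hpin hexplZ hp₀⟩

/-- [folklore] An off-centre image ball with a small centre lies in the centred ball of the summed radius:
`‖c‖ ≤ P`, `MapsTo Φ S (closedBall c B₁)` ⇒ `MapsTo Φ S (closedBall 0 (P + B₁))`. -/
theorem mapsTo_closedBall_zero_of_centre_le {X Y : Type*} [SeminormedAddCommGroup Y] {Φ : X → Y} {S : Set X} {c : Y}
    {P B₁ : ℝ} (hc : ‖c‖ ≤ P) (hm : MapsTo Φ S (closedBall c B₁)) : MapsTo Φ S (closedBall 0 (P + B₁)) := by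
  intro x hx
  have h := hm hx
  rw [mem_closedBall, dist_eq_norm] at h
  rw [mem_closedBall, dist_zero_right]
  calc ‖Φ x‖ = ‖(Φ x - c) + c‖ := by rw [sub_add_cancel]
    _ ≤ ‖Φ x - c‖ + ‖c‖ := norm_add_le _ _
    _ ≤ B₁ + P := add_le_add h hc
    _ = P + B₁ := add_comm _ _

/-- **CONSISTENCY WITH E132 §4** — the off-centre clause (§2) gives back the CENTRED (Φ-size) clause of
`NE9HoloFamilyPotentialKPG.vacSlice_clauses_of_potentialKPG` with its budget `2B + p̄₀`; so the record's ENDs at rate `θ` (E130 ∕ E132 ∕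
E134, room `ω̂·R₀ + τ̄·(2B + p̄₀) ≤ θ·R₀`) stay available from the off-centre letters, and the translation-aware chain only improves the
rate downstream. [cite: Balaban1988RG2Cluster, (2.38) p.20 and (2.40)-(2.41) p.21] -/
theorem vacSlice_mapsTo_zero_of_offCentre (G : ClusterGeom C) {σ : lp (fun _ : ι => ℂ) ∞ →L[ℝ] lp (fun _ : ι => ℂ) ∞}
    (hσ : ∀ (c : ℂ) (x : lp (fun _ : ι => ℂ) ∞), σ (c • x) = conj c • σ x) (hiso : ∀ x, ‖σ x‖ = ‖x‖)
    {act : ℕ → ℝ → Bg → lp (fun _ : ι => ℂ) ∞ → G.P → ℂ} {m : ℕ → ℝ → Bg → G.P → ℝ} {a d : G.P → ℝ}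
    {δ : C.Dom → ℝ} {U₀ : Bg} {explZ : ℕ → Bg → C.Dom → ℝ} {p₀ : ℕ → ℝ} {R₀ B pbar : ℝ}
    (hB : 0 ≤ B) (hpbar : 0 ≤ pbar) (hKP : G.PotentialKPG W act m a d R₀)
    (hdec : G.DecayExtract δ d) (hpin : G.PinBudget a δ (fun _ => B) κ)
    (hexplZ : ∀ (k : ℕ) (U : Bg) (X : C.Dom), C.scale X = k + 1 → |explZ k U X| ≤ Real.exp (-(κ * C.d X)) * p₀ k)
    (hp₀ : ∀ k, p₀ k ≤ pbar) :
    ∀ k, ∀ g ∈ W, MapsTo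
      (holoSlice κ σ (fun k s Q U X => G.newTerm act k s U X Q - G.newTerm act k s U₀ X Q + ((explZ k U X : ℝ) : ℂ)) k (g k))
      (ball (0 : lp (fun _ : ι => ℂ) ∞) R₀) (closedBall 0 (pbar + 2 * B)) := by
  obtain ⟨hc, hm⟩ := vacSlice_offCentre_of_potentialKPG (W := W) (κ := κ) G hσ hiso hB hpbar hKP hdec hpin hexplZ hp₀
  exact fun k g hg => mapsTo_closedBall_zero_of_centre_le (hc k) (hm k g hg)

end Record

end Summit.QuantumFields.BalabanUV.T4Continuum.NE9HoloFamilyOffCentre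

end
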